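import Literature.NumberTheory.Sieve.HeathBrownCubicLemma93Main
import Literature.NumberTheory.Sieve.HeathBrownCubicGrossenPrimeSums
import HarnessLib

/-!
# Lemma 9.3: the non-trivial characters ((9.7)–(9.9))

Sequel of `HeathBrownCubicLemma93Core`/`HeathBrownCubicLemma93Main` in the reduction *Lemma 9.2 ⇐ Lemma 9.4* of §9 of
D. R. Heath-Brown, *Primes represented by `x³ + 2y³`*, Acta Math. 186 (2001) (route to `HeathBrown2001_lemma_3_8`).
Pages 55–56: "We now write `Σ_{j,k} = (m₁ξ log X)⁻¹ ∑_J g_J ν(J) ∑_P ν(P) log N(P)`, where `J` runs over products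
`P₂⋯P_{n+1}` with `N(P_i) ∈ J(m_i)`, and `g_J = ∏_{i=2}^{n+1} log N(P_i)/(m_iξ log X)`. Moreover the sum over `P`
is for `N(P) ∈ J(m₁)` and `N(𝐱) < N(P) ≤ (N(𝐱)+ΔV)/Π` (9.7) … Lemma 9.4 now yields
`Σ_{j,k} ≪_A (m₁ξ log X)⁻¹ ∑_J g_J (V/Π) exp{−c(log L)^{1/2}}` … Since `∑ log N(P)/N(P) ≪ m⁻¹ξ log X` (9.8) we
deduce … `E_{j,k} ≪_A M⁻¹V exp{−c(log L)^{1/2}}` (9.9)." This file PROVES (9.9) in explicit form, with the LAST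
prime of the tuple as the free variable (any coordinate has range `≥ X^τ`) and with Lemma 9.4 entering as the
hypothesis `|θ_ν(u)| ≤ C₉ue^{−c₉√(log u)}` for `u ≥ A₀` on the prime sums of `HeathBrownCubicGrossenPrimeSums`:

* `sum_piFinset_eq_sum_snoc'`, `tupleNorm_snoc`, `tupleIdeal_snoc`, `tupleCoeff_snoc`, **`Ejk_eq_sum_init`** — (9.7);
* `filter_Jprimes_window_eq` — the inner range as a window `(a*, b*]` of first-degree primes (integer windows);
  **`norm_innerWindow_le`** — the inner sum is `≤ B(2C₉e^{−c₉√(log A₀)} + 12Λ/√A₀)` (the degree `≥ 2` primes cost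
  `6(√b + 1) log b`, and `√b ≤ b/√A₀`);
* `sum_Jprimes_log_div_le` — (9.8) with the explicit constant of `sum_log_div_absNorm_le`
  (`∑_{𝒥(m)} log N(P)/N(P) ≤ (1 + C₀e^{−c√(log X^{mξ})})ξ log X + (8 + 2C₀)`), `sum_initCoeff_div_initNorm_le` — its
  product over the coordinates (`Finset.prod_univ_sum`);
* **`norm_Ejk_le_of_theta`** — (9.9):
  `|E_{j,k}(𝐱)| ≤ (N(𝐱)+ΔV)(2C₉e^{−c₉√(log A₀)} + 18 log X/√A₀)(1 + δ)^n/(Mξ log X)`,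
  `δ = C₀e^{−c√(τ log X)} + (8+2C₀)/(ξ log X)`.

## References

* D. R. Heath-Brown, *Primes represented by `x³ + 2y³`*, Acta Math. 186 (2001), §9 pp. 55–56, (9.7)–(9.9).
  [cite: HeathBrownActa2001, §9 (9.9)]
* G. Harman, *Prime-Detecting Sieves* (2007), (13.6.14). [cite: Harman2007, Lemma 13.20]

## Mathlib / tree search

Tree: `sum_log_div_absNorm_le`, `sum_piFinset_eq_sum_snoc` (real-valued; re-proved for any monoid of values)
(`HeathBrownCubicPrimeTuples`), `abs_degreeOneTheta_sub_self_le` (`DegreeOnePrimesPNT`, the shape of `hθ₁`), `log_hbBox_ratio`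
(`HeathBrownCubicWCalculus`), `primesIoc`, `norm_sum_primesIoc_firstDegree_le`, `le_absNorm_iff_ceil_sub_one_lt`,
`absNorm_lt_iff_le_ceil_sub_one` (`HeathBrownCubicGrossenPrimeSums`), `Ejk`, `tupleCoeff`, `tupleNorm` (`HeathBrownCubicLemma93Core`).
Mathlib: `Finset.filter_piFinset_eq_map_snocEquiv`, `Fin.prod_univ_castSucc`, `Finset.prod_univ_sum`, `Finset.single_le_sum`.
-/

noncomputable section

open Polynomial NumberField Finset Complex

namespace Literature.NumberTheory.Sieve.CubicSieve

open LFunctions.CubeRootTwoField CubicPrimes Literature.NumberTheory.LFunctions.NumberField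

/-! ### Splitting the last prime off a tuple -/

/-- Splitting a sum over `piFinset S` (`S : Fin (n+1) → Finset α`) along the last coordinate, for any
additive commutative monoid of values (`HeathBrownCubicPrimeTuples.sum_piFinset_eq_sum_snoc` is the real case).
[folklore] -/
theorem sum_piFinset_eq_sum_snoc' {α M : Type*} [DecidableEq α] [AddCommMonoid M] {n : ℕ} (S : Fin (n + 1) → Finset α)
    (f : (Fin (n + 1) → α) → M) :
    ∑ r ∈ Fintype.piFinset S, f r = ∑ y ∈ S (Fin.last n), ∑ r' ∈ Fintype.piFinset (Fin.init S), f (Fin.snoc r' y) := by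
  have h := Finset.filter_piFinset_eq_map_snocEquiv S (fun _ => True)
  rw [Finset.filter_true, Finset.filter_true] at h
  rw [h, sum_map, sum_product]
  rfl

variable {X τ : ℝ} {n : ℕ} {m : Fin (n + 1) → ℕ}

/-- The truncated exponent vector `(m_1, …, m_n)`. [folklore] -/
def mInit (m : Fin (n + 1) → ℕ) : Fin n → ℕ := fun i => m (Fin.castSucc i)

/-- `∏ N(r'_i)` for the truncated tuple. [folklore] -/
def initNorm (r' : Fin n → Ideal (𝓞 K)) : ℝ := ∏ i, (Ideal.absNorm (r' i) : ℝ)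

/-- `∏ log N(r'_i)/(m_i ξ log X)` for the truncated tuple. [folklore] -/
def initCoeff (X τ : ℝ) (m : Fin (n + 1) → ℕ) (r' : Fin n → Ideal (𝓞 K)) : ℝ :=
  ∏ i, Real.log (Ideal.absNorm (r' i)) / ((mInit m i : ℝ) * hbXi τ * Real.log X)

/-- `initNorm > 0` on the support (non-zero ideals). [folklore] -/
theorem initNorm_pos {r' : Fin n → Ideal (𝓞 K)} (hr : ∀ i, r' i ≠ ⊥) : 0 < initNorm r' := by
  rw [initNorm]
  refine Finset.prod_pos fun i _ => ?_
  have : 0 < Ideal.absNorm (r' i) := Nat.pos_of_ne_zero (by rw [Ne, Ideal.absNorm_eq_zero_iff]; exact hr i)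
  exact_mod_cast this

/-- `tupleNorm (snoc r' y) = initNorm r' · N(y)`. [folklore] -/
theorem tupleNorm_snoc (r' : Fin n → Ideal (𝓞 K)) (y : Ideal (𝓞 K)) :
    tupleNorm (Fin.snoc (α := fun _ => Ideal (𝓞 K)) r' y) = initNorm r' * (Ideal.absNorm y : ℝ) := by
  rw [tupleNorm, initNorm, Fin.prod_univ_castSucc]
  simp [Fin.snoc_castSucc, Fin.snoc_last]

/-- `tupleIdeal (snoc r' y) = (∏ r'_i) · y`. [folklore] -/
theorem tupleIdeal_snoc (r' : Fin n → Ideal (𝓞 K)) (y : Ideal (𝓞 K)) :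
    tupleIdeal (Fin.snoc (α := fun _ => Ideal (𝓞 K)) r' y) = (∏ i, r' i) * y := by
  rw [tupleIdeal, Fin.prod_univ_castSucc]
  simp [Fin.snoc_castSucc, Fin.snoc_last]

/-- `tupleCoeff (snoc r' y) = initCoeff r' · log N(y)/(m_{n+1} ξ log X)`. [folklore] -/
theorem tupleCoeff_snoc (r' : Fin n → Ideal (𝓞 K)) (y : Ideal (𝓞 K)) :
    tupleCoeff X τ m (Fin.snoc (α := fun _ => Ideal (𝓞 K)) r' y) =
      initCoeff X τ m r' * (Real.log (Ideal.absNorm y) / ((m (Fin.last n) : ℝ) * hbXi τ * Real.log X)) := by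
  rw [tupleCoeff, initCoeff, Fin.prod_univ_castSucc]
  simp [Fin.snoc_castSucc, Fin.snoc_last, mInit]

/-- **`E_{j,k}` with the last prime separated** ((9.7): "`Σ_{j,k} = (m₁ξ log X)⁻¹ ∑_J g_J ν(J) ∑_P ν(P) log N(P)`",
here with the last rather than the first prime as the free variable):
`E_{j,k}(𝐱) = ∑_{r'} c'(r') ν(∏ r') (m_{n+1}ξ log X)⁻¹ ∑_{y ∈ 𝒥(m_{n+1}), N(𝐱) < N(y)·Π' ≤ N(𝐱)+ΔV} ν(y) log N(y)`.
[cite: HeathBrownActa2001, §9 (9.7)] -/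
theorem Ejk_eq_sum_init {q : ℕ} (hq : 1 ≤ q) (χ : MulChar (QuotMod q) ℂ) (j k : ℤ) (Δ V : ℝ) (x : ℝ × ℝ × ℝ) :
    Ejk X τ m hq χ j k Δ V x =
      ∑ r' ∈ Fintype.piFinset (fun i => Jprimes X τ (mInit m i)),
        (initCoeff X τ m r' : ℂ) * grossenChar hq χ j k (∏ i, r' i) * ((((m (Fin.last n) : ℝ) * hbXi τ * Real.log X)⁻¹ : ℝ) : ℂ) *
          ∑ y ∈ (Jprimes X τ (m (Fin.last n))).filter
              (fun y => normForm x < initNorm r' * (Ideal.absNorm y : ℝ) ∧ initNorm r' * (Ideal.absNorm y : ℝ) ≤ normForm x + Δ * V),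
            grossenChar hq χ j k y * Real.log (Ideal.absNorm y) := by
  classical
  rw [Ejk, sum_piFinset_eq_sum_snoc', Finset.sum_comm]
  have hinit : Fintype.piFinset (Fin.init fun i => Jprimes X τ (m i)) = Fintype.piFinset fun i => Jprimes X τ (mInit m i) := by
    rfl
  rw [hinit]
  refine Finset.sum_congr rfl fun r' _ => ?_
  rw [Finset.mul_sum, Finset.sum_filter]
  refine Finset.sum_congr rfl fun y _ => ?_
  simp only [InNormWindow, tupleNorm_snoc]
  split_ifs with hw
  · rw [tupleCoeff_snoc, tupleIdeal_snoc, map_mul]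
    push_cast
    ring
  · rfl

/-! ### The inner window of first-degree primes ((9.7)–(9.8)) -/

/-- **The inner range as a window `(a*, b*]`**: for `Π > 0`, the primes `y ∈ 𝒥(M')` with
`A₁ < Π·N(y) ≤ A₂` are exactly the first-degree primes with `a* < N(y) ≤ b*`,
`a* = max(⌈X^{M'ξ}⌉ − 1, A₁/Π)`, `b* = min(⌈X^{(M'+1)ξ}⌉ − 1, A₂/Π)` (norms are integers). [folklore] -/
theorem filter_Jprimes_window_eq (hX : 0 < X) (M' : ℕ) {Pp A₁ A₂ : ℝ} (hPp : 0 < Pp) :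
    (Jprimes X τ M').filter (fun y => A₁ < Pp * (Ideal.absNorm y : ℝ) ∧ Pp * (Ideal.absNorm y : ℝ) ≤ A₂) =
      (primesIoc (max ((⌈X ^ ((M' : ℝ) * hbXi τ)⌉₊ : ℝ) - 1) (A₁ / Pp))
          (min ((⌈X ^ (((M' : ℝ) + 1) * hbXi τ)⌉₊ : ℝ) - 1) (A₂ / Pp))).filter fun y => (Ideal.absNorm y).Prime := by
  ext y
  rw [mem_filter, mem_Jprimes_iff, mem_filter, mem_primesIoc, max_lt_iff, le_min_iff,
    ← le_absNorm_iff_ceil_sub_one_lt (Real.rpow_nonneg hX.le _), ← absNorm_lt_iff_le_ceil_sub_one,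
    div_lt_iff₀ hPp, le_div_iff₀ hPp, mul_comm ((Ideal.absNorm y : ℝ)) Pp]
  tauto

/-- **The inner sum bound** ((9.8)–(9.9) for one `J`): if `|θ_ν(u)| ≤ C₉ u e^{−c₉√(log u)}` for all `u ≥ A₀ ≥ 1`
and `|ν| ≤ 1`, then for `a ≥ A₀`, `b ≤ B` (`B ≥ 0`) with `log b ≤ Λ` (`Λ ≥ 0`),
`|∑_{a < N(y) ≤ b, N(y) prime} ν(y) log N(y)| ≤ B (2C₉ e^{−c₉√(log A₀)} + 12Λ/√A₀)`.
[cite: HeathBrownActa2001, §9 (9.8)] -/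
theorem norm_innerWindow_le {ν : Ideal (𝓞 K) → ℂ} (hν : ∀ P, ‖ν P‖ ≤ 1) {A₀ C₉ c₉ Λ : ℝ} (hA₀ : 1 ≤ A₀)
    (hc₉ : 0 ≤ c₉) (hC₉ : 0 ≤ C₉) (hΛ : 0 ≤ Λ)
    (hθ : ∀ u : ℝ, A₀ ≤ u → ‖grossenTheta ν u‖ ≤ C₉ * u * Real.exp (-(c₉ * Real.sqrt (Real.log u))))
    {a b B : ℝ} (ha : A₀ ≤ a) (hb : b ≤ B) (hB : 0 ≤ B) (hbΛ : Real.log b ≤ Λ) :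
    ‖∑ P ∈ (primesIoc a b).filter (fun P => (Ideal.absNorm P).Prime), ν P * Real.log (Ideal.absNorm P)‖ ≤
      B * (2 * C₉ * Real.exp (-(c₉ * Real.sqrt (Real.log A₀))) + 12 * Λ / Real.sqrt A₀) := by
  classical
  have hA₀pos : 0 < A₀ := by linarith
  have hsA : 0 < Real.sqrt A₀ := Real.sqrt_pos.mpr hA₀pos
  have hE : 0 ≤ Real.exp (-(c₉ * Real.sqrt (Real.log A₀))) := (Real.exp_pos _).le
  have hRHS : 0 ≤ B * (2 * C₉ * Real.exp (-(c₉ * Real.sqrt (Real.log A₀))) + 12 * Λ / Real.sqrt A₀) := by positivity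
  rcases lt_or_ge b a with hba | hab
  · -- empty window
    have : (primesIoc a b).filter (fun P => (Ideal.absNorm P).Prime) = ∅ := by
      rw [Finset.filter_eq_empty_iff]
      intro P hP
      rw [mem_primesIoc] at hP; linarith [hP.2.2.1, hP.2.2.2]
    rw [this, Finset.sum_empty, norm_zero]; exact hRHS
  · have ha1 : 1 ≤ a := hA₀.trans ha
    have hb0 : 0 < b := by linarith
    have h1 := norm_sum_primesIoc_firstDegree_le hν ha1 hab hc₉ hC₉ (hθ a ha) (hθ b (ha.trans hab))
    have hexp : Real.exp (-(c₉ * Real.sqrt (Real.log a))) ≤ Real.exp (-(c₉ * Real.sqrt (Real.log A₀))) := by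
      apply Real.exp_le_exp.mpr
      have : Real.sqrt (Real.log A₀) ≤ Real.sqrt (Real.log a) := Real.sqrt_le_sqrt (Real.log_le_log hA₀pos ha)
      nlinarith
    have hsb : Real.sqrt A₀ ≤ Real.sqrt b := Real.sqrt_le_sqrt (ha.trans hab)
    have hsb1 : 1 ≤ Real.sqrt b := by rw [← Real.sqrt_one]; exact Real.sqrt_le_sqrt (ha1.trans hab)
    have hlogb : 0 ≤ Real.log b := Real.log_nonneg (ha1.trans hab)
    -- `6(√b + 1) log b ≤ 12 √b Λ ≤ 12 (b/√A₀) Λ`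
    have h2 : 6 * (Real.sqrt b + 1) * Real.log b ≤ 12 * Λ / Real.sqrt A₀ * b := by
      have hbs : Real.sqrt b ≤ b / Real.sqrt A₀ := by
        rw [le_div_iff₀ hsA]
        calc Real.sqrt b * Real.sqrt A₀ ≤ Real.sqrt b * Real.sqrt b := by gcongr
          _ = b := Real.mul_self_sqrt hb0.le
      calc 6 * (Real.sqrt b + 1) * Real.log b ≤ 6 * (Real.sqrt b + Real.sqrt b) * Λ := by gcongr
        _ = 12 * Real.sqrt b * Λ := by ring
        _ ≤ 12 * (b / Real.sqrt A₀) * Λ := by gcongr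
        _ = 12 * Λ / Real.sqrt A₀ * b := by ring
    have h3 : 2 * C₉ * b * Real.exp (-(c₉ * Real.sqrt (Real.log a))) ≤ 2 * C₉ * B * Real.exp (-(c₉ * Real.sqrt (Real.log A₀))) := by
      have h2C : 0 ≤ 2 * C₉ := by positivity
      calc 2 * C₉ * b * Real.exp (-(c₉ * Real.sqrt (Real.log a))) = (2 * C₉) * (b * Real.exp (-(c₉ * Real.sqrt (Real.log a)))) := by ring
        _ ≤ (2 * C₉) * (B * Real.exp (-(c₉ * Real.sqrt (Real.log A₀)))) :=
            mul_le_mul_of_nonneg_left (mul_le_mul hb hexp (Real.exp_pos _).le hB) h2C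
        _ = 2 * C₉ * B * Real.exp (-(c₉ * Real.sqrt (Real.log A₀))) := by ring
    have h4 : 12 * Λ / Real.sqrt A₀ * b ≤ 12 * Λ / Real.sqrt A₀ * B :=
      mul_le_mul_of_nonneg_left hb (by positivity)
    calc ‖∑ P ∈ (primesIoc a b).filter (fun P => (Ideal.absNorm P).Prime), ν P * Real.log (Ideal.absNorm P)‖
        ≤ 2 * C₉ * b * Real.exp (-(c₉ * Real.sqrt (Real.log a))) + 6 * (Real.sqrt b + 1) * Real.log b := h1
      _ ≤ 2 * C₉ * B * Real.exp (-(c₉ * Real.sqrt (Real.log A₀))) + 12 * Λ / Real.sqrt A₀ * B :=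
          add_le_add h3 (h2.trans h4)
      _ = B * (2 * C₉ * Real.exp (-(c₉ * Real.sqrt (Real.log A₀))) + 12 * Λ / Real.sqrt A₀) := by ring

/-! ### The outer product ((9.8)) -/

/-- The summand `c'(r')/Π'(r')` is the product of `(log N(P)/(m_iξ log X))/N(P)` over the coordinates. [folklore] -/
theorem initCoeff_div_initNorm (r' : Fin n → Ideal (𝓞 K)) :
    initCoeff X τ m r' / initNorm r' =
      ∏ i, (Real.log (Ideal.absNorm (r' i)) / ((mInit m i : ℝ) * hbXi τ * Real.log X)) / (Ideal.absNorm (r' i) : ℝ) := by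
  rw [initCoeff, initNorm, ← Finset.prod_div_distrib]

/-- **(9.8): the window sum of `log N(P)/N(P)` over `𝒥(m)` is `≤ m⁻¹(1 + δ)`** after division by `mξ log X`,
`δ = C₀e^{−c√(τ log X)} + (8 + 2C₀)/(ξ log X)`, from the degree-one prime number theorem in the form
`|θ₁(x) − x| ≤ C₀ x e^{−c√(log x)}` (`sum_log_div_absNorm_le`). [cite: HeathBrownActa2001, §9 (9.8)] -/
theorem sum_Jprimes_log_div_le {c C₀ : ℝ} (hc : 0 ≤ c) (hC₀ : 0 ≤ C₀)
    (hθ₁ : ∀ x : ℝ, 2 ≤ x → |degreeOneTheta K x - x| ≤ C₀ * x * Real.exp (-c * Real.sqrt (Real.log x)))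
    (hX : 1 < X) (hτ : 0 < τ) (h3 : 3 ≤ X ^ τ) {M' : ℕ} (hM' : τ / hbXi τ ≤ (M' : ℝ)) (hM'1 : 1 ≤ M') :
    ∑ P ∈ Jprimes X τ M', (Real.log (Ideal.absNorm P) / ((M' : ℝ) * hbXi τ * Real.log X)) / (Ideal.absNorm P : ℝ) ≤
      (M' : ℝ)⁻¹ * (1 + (C₀ * Real.exp (-c * Real.sqrt (τ * Real.log X)) + (8 + 2 * C₀) / (hbXi τ * Real.log X))) := by
  have hX0 : 0 < X := by linarith
  have hξ := hbXi_pos hτ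
  have hlogX := Real.log_pos hX
  have hden : 0 < (M' : ℝ) * hbXi τ * Real.log X := by
    have : (0 : ℝ) < M' := by exact_mod_cast hM'1
    positivity
  set lo : ℝ := X ^ ((M' : ℝ) * hbXi τ) with hlo
  set hi : ℝ := X ^ (((M' : ℝ) + 1) * hbXi τ) with hhi
  have hlo_ge : X ^ τ ≤ lo := by
    rw [hlo]; refine Real.rpow_le_rpow_of_exponent_le hX.le ?_
    rwa [div_le_iff₀ hξ] at hM'
  have hlo3 : 3 ≤ lo := h3.trans hlo_ge
  have hlohi : lo ≤ hi := Real.rpow_le_rpow_of_exponent_le hX.le (by nlinarith)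
  have hF : ∀ P, P ∈ Jprimes X τ M' ↔ P.IsPrime ∧ P ≠ ⊥ ∧ lo ≤ (Ideal.absNorm P : ℝ) ∧
      (Ideal.absNorm P : ℝ) < hi ∧ (Ideal.absNorm P).Prime := fun P => mem_Jprimes_iff X τ
  have h1 := sum_log_div_absNorm_le hθ₁ hc hC₀ hF hlo3 hlohi
  rw [hhi, hlo, log_hbBox_ratio hX0 τ M'] at h1
  have hsum : ∑ P ∈ Jprimes X τ M', (Real.log (Ideal.absNorm P) / ((M' : ℝ) * hbXi τ * Real.log X)) / (Ideal.absNorm P : ℝ) =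
      ((M' : ℝ) * hbXi τ * Real.log X)⁻¹ * ∑ P ∈ Jprimes X τ M', Real.log (Ideal.absNorm P) / (Ideal.absNorm P : ℝ) := by
    rw [Finset.mul_sum]; refine Finset.sum_congr rfl fun P _ => ?_; field_simp
  rw [hsum]
  -- `ε(lo) ≤ ε(X^τ)`
  have hε : Real.exp (-c * Real.sqrt (Real.log (X ^ ((M' : ℝ) * hbXi τ)))) ≤ Real.exp (-c * Real.sqrt (τ * Real.log X)) := by
    apply Real.exp_le_exp.mpr
    have : Real.sqrt (τ * Real.log X) ≤ Real.sqrt (Real.log (X ^ ((M' : ℝ) * hbXi τ))) := by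
      apply Real.sqrt_le_sqrt
      rw [← Real.log_rpow hX0 τ]; exact Real.log_le_log (by positivity) hlo_ge
    nlinarith
  calc ((M' : ℝ) * hbXi τ * Real.log X)⁻¹ * ∑ P ∈ Jprimes X τ M', Real.log (Ideal.absNorm P) / (Ideal.absNorm P : ℝ)
      ≤ ((M' : ℝ) * hbXi τ * Real.log X)⁻¹ *
          ((1 + C₀ * Real.exp (-c * Real.sqrt (Real.log (X ^ ((M' : ℝ) * hbXi τ))))) * (hbXi τ * Real.log X) + (8 + 2 * C₀)) :=
        mul_le_mul_of_nonneg_left h1 (inv_nonneg.mpr hden.le)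
    _ ≤ ((M' : ℝ) * hbXi τ * Real.log X)⁻¹ *
          ((1 + C₀ * Real.exp (-c * Real.sqrt (τ * Real.log X))) * (hbXi τ * Real.log X) + (8 + 2 * C₀)) := by
        gcongr
    _ = (M' : ℝ)⁻¹ * (1 + (C₀ * Real.exp (-c * Real.sqrt (τ * Real.log X)) + (8 + 2 * C₀) / (hbXi τ * Real.log X))) := by
        field_simp
        ring

/-- **The outer product**: `∑_{r'} c'(r')/Π'(r') ≤ (∏_{i<n} m_i)⁻¹ (1 + δ)^n` ((9.8) multiplied over the
coordinates, `Finset.prod_univ_sum`). [cite: HeathBrownActa2001, §9 (9.8)] -/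
theorem sum_initCoeff_div_initNorm_le {c C₀ : ℝ} (hc : 0 ≤ c) (hC₀ : 0 ≤ C₀)
    (hθ₁ : ∀ x : ℝ, 2 ≤ x → |degreeOneTheta K x - x| ≤ C₀ * x * Real.exp (-c * Real.sqrt (Real.log x)))
    (hX : 1 < X) (hτ : 0 < τ) (hτ1 : τ ≤ 1) (h3 : 3 ≤ X ^ τ) (hm : CoreAdmissible τ m) :
    ∑ r' ∈ Fintype.piFinset (fun i => Jprimes X τ (mInit m i)), initCoeff X τ m r' / initNorm r' ≤
      (∏ i, (mInit m i : ℝ))⁻¹ * (1 + (C₀ * Real.exp (-c * Real.sqrt (τ * Real.log X)) + (8 + 2 * C₀) / (hbXi τ * Real.log X))) ^ n := by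
  simp_rw [initCoeff_div_initNorm]
  rw [← Finset.prod_univ_sum (fun i => Jprimes X τ (mInit m i))
    (fun i P => (Real.log (Ideal.absNorm P) / ((mInit m i : ℝ) * hbXi τ * Real.log X)) / (Ideal.absNorm P : ℝ))]
  have hmi : ∀ i : Fin n, τ / hbXi τ ≤ (mInit m i : ℝ) ∧ 1 ≤ mInit m i := by
    intro i
    have h := hm.2.1 (Fin.castSucc i)
    refine ⟨h, ?_⟩
    have h1 : (1 : ℝ) ≤ m (Fin.castSucc i) := by
      refine le_trans ?_ h
      rw [le_div_iff₀ (hbXi_pos hτ), one_mul]; exact hbXi_le hτ.le hτ1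
    exact_mod_cast h1
  have hfac : ∀ i : Fin n, ∑ P ∈ Jprimes X τ (mInit m i), (Real.log (Ideal.absNorm P) / ((mInit m i : ℝ) * hbXi τ * Real.log X)) / (Ideal.absNorm P : ℝ) ≤
      (mInit m i : ℝ)⁻¹ * (1 + (C₀ * Real.exp (-c * Real.sqrt (τ * Real.log X)) + (8 + 2 * C₀) / (hbXi τ * Real.log X))) :=
    fun i => sum_Jprimes_log_div_le hc hC₀ hθ₁ hX hτ h3 (hmi i).1 (hmi i).2
  have hnonneg : ∀ i : Fin n, 0 ≤ ∑ P ∈ Jprimes X τ (mInit m i), (Real.log (Ideal.absNorm P) / ((mInit m i : ℝ) * hbXi τ * Real.log X)) / (Ideal.absNorm P : ℝ) := by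
    intro i
    refine Finset.sum_nonneg fun P _ => div_nonneg (div_nonneg (Real.log_natCast_nonneg _) ?_) (Nat.cast_nonneg _)
    have := hbXi_pos hτ; have := Real.log_pos hX; positivity
  calc ∏ i, ∑ P ∈ Jprimes X τ (mInit m i), (Real.log (Ideal.absNorm P) / ((mInit m i : ℝ) * hbXi τ * Real.log X)) / (Ideal.absNorm P : ℝ)
      ≤ ∏ i : Fin n, (mInit m i : ℝ)⁻¹ * (1 + (C₀ * Real.exp (-c * Real.sqrt (τ * Real.log X)) + (8 + 2 * C₀) / (hbXi τ * Real.log X))) :=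
        Finset.prod_le_prod (fun i _ => hnonneg i) (fun i _ => hfac i)
    _ = (∏ i, (mInit m i : ℝ))⁻¹ * (1 + (C₀ * Real.exp (-c * Real.sqrt (τ * Real.log X)) + (8 + 2 * C₀) / (hbXi τ * Real.log X))) ^ n := by
        rw [Finset.prod_mul_distrib, Finset.prod_inv_distrib, Finset.prod_const, Finset.card_univ, Fintype.card_fin]

/-! ### (9.9): the bound for a non-trivial `E_{j,k}(𝐱)` -/

/-- `initCoeff ≥ 0` (`X > 1`, `τ > 0`). [folklore] -/
theorem initCoeff_nonneg (hX : 1 < X) (hτ : 0 < τ) (r' : Fin n → Ideal (𝓞 K)) : 0 ≤ initCoeff X τ m r' := by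
  rw [initCoeff]
  refine Finset.prod_nonneg fun i _ => div_nonneg (Real.log_natCast_nonneg _) ?_
  have := hbXi_pos hτ; have := Real.log_pos hX
  positivity

/-- `(m_{n+1} + 1)ξ ≤ 3/2` under (3.7), so `X^{(m_{n+1}+1)ξ} ≤ X^{3/2}`. [cite: HeathBrownActa2001, §3 (3.7)] -/
theorem rpow_last_le (hX : 1 ≤ X) (hτ : 0 < τ) (hm : CoreAdmissible τ m) :
    X ^ (((m (Fin.last n) : ℝ) + 1) * hbXi τ) ≤ X ^ (3 / 2 : ℝ) := by
  refine Real.rpow_le_rpow_of_exponent_le hX ?_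
  have hξ := hbXi_pos hτ
  have h7 := hm.2.2.2
  rw [le_div_iff₀ hξ] at h7
  have hle : ((m (Fin.last n) : ℝ) + 1) ≤ ∑ i, ((m i : ℝ) + 1) :=
    Finset.single_le_sum (f := fun i => (m i : ℝ) + 1) (fun i _ => by positivity) (Finset.mem_univ (Fin.last n))
  nlinarith

/-- **(9.9): a non-trivial `E_{j,k}(𝐱)` is small.** If `θ_ν(u) = ∑_{N(P)≤u} ν(P) log N(P)` satisfies
`|θ_ν(u)| ≤ C₉ u e^{−c₉√(log u)}` for all `u ≥ A₀` (`1 ≤ A₀ ≤ X^τ − 1`) — the conclusion of Lemma 9.4 for the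
character `ν = ν^{(j,k)}` in the relevant range — then
`|E_{j,k}(𝐱)| ≤ (N(𝐱)+ΔV)·(2C₉e^{−c₉√(log A₀)} + 18 log X/√A₀)·(1 + δ)^n/(M ξ log X)`,
`δ = C₀e^{−c√(τ log X)} + (8+2C₀)/(ξ log X)` (from (9.8); `(1 + δ)^n = e^{O(1)}` by (2.5), (3.4)), `M = ∏ m_i`.
[cite: HeathBrownActa2001, §9 (9.9)] -/
theorem norm_Ejk_le_of_theta {q : ℕ} (hq : 1 ≤ q) (χ : MulChar (QuotMod q) ℂ) (j k : ℤ)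
    {c C₀ : ℝ} (hc : 0 ≤ c) (hC₀ : 0 ≤ C₀)
    (hθ₁ : ∀ x : ℝ, 2 ≤ x → |degreeOneTheta K x - x| ≤ C₀ * x * Real.exp (-c * Real.sqrt (Real.log x)))
    (hX : 1 < X) (hτ : 0 < τ) (hτ1 : τ ≤ 1) (h3 : 3 ≤ X ^ τ) (hm : CoreAdmissible τ m)
    {A₀ C₉ c₉ : ℝ} (hA₀ : 1 ≤ A₀) (hA₀X : A₀ + 1 ≤ X ^ τ) (hc₉ : 0 ≤ c₉) (hC₉ : 0 ≤ C₉)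
    (hθ : ∀ u : ℝ, A₀ ≤ u → ‖grossenTheta (grossenChar hq χ j k) u‖ ≤ C₉ * u * Real.exp (-(c₉ * Real.sqrt (Real.log u))))
    {Δ V : ℝ} (hΔV : 0 ≤ Δ * V) {x : ℝ × ℝ × ℝ} (hNx : 0 < normForm x) :
    ‖Ejk X τ m hq χ j k Δ V x‖ ≤
      (normForm x + Δ * V) * (2 * C₉ * Real.exp (-(c₉ * Real.sqrt (Real.log A₀))) + 12 * (3 / 2 * Real.log X) / Real.sqrt A₀) *
        (1 + (C₀ * Real.exp (-c * Real.sqrt (τ * Real.log X)) + (8 + 2 * C₀) / (hbXi τ * Real.log X))) ^ n /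
        ((∏ i, (m i : ℝ)) * (hbXi τ * Real.log X)) := by
  classical
  have hX0 : 0 < X := by linarith
  have hξ := hbXi_pos hτ
  have hlogX := Real.log_pos hX
  set δ : ℝ := C₀ * Real.exp (-c * Real.sqrt (τ * Real.log X)) + (8 + 2 * C₀) / (hbXi τ * Real.log X) with hδ
  have hδ0 : 0 ≤ δ := by positivity
  set E₁ : ℝ := 2 * C₉ * Real.exp (-(c₉ * Real.sqrt (Real.log A₀))) + 12 * (3 / 2 * Real.log X) / Real.sqrt A₀ with hE₁
  have hE₁0 : 0 ≤ E₁ := by positivity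
  set A₂ : ℝ := normForm x + Δ * V with hA₂
  have hA₂0 : 0 < A₂ := by rw [hA₂]; linarith
  set den : ℝ := (m (Fin.last n) : ℝ) * hbXi τ * Real.log X with hden
  have hmlast : (1 : ℝ) ≤ m (Fin.last n) := by
    refine le_trans ?_ (hm.2.1 (Fin.last n))
    rw [le_div_iff₀ hξ, one_mul]; exact hbXi_le hτ.le hτ1
  have hden0 : 0 < den := by rw [hden]; positivity
  -- the range of the last prime
  set lo : ℝ := X ^ ((m (Fin.last n) : ℝ) * hbXi τ) with hlo
  set hi : ℝ := X ^ (((m (Fin.last n) : ℝ) + 1) * hbXi τ) with hhi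
  have hlo_ge : X ^ τ ≤ lo := by
    rw [hlo]; refine Real.rpow_le_rpow_of_exponent_le hX.le ?_
    have := hm.2.1 (Fin.last n); rwa [div_le_iff₀ hξ] at this
  have hhi_le : hi ≤ X ^ (3 / 2 : ℝ) := rpow_last_le hX.le hτ hm
  have hhi0 : 0 < hi := Real.rpow_pos_of_pos hX0 _
  rw [Ejk_eq_sum_init hq χ j k Δ V x]
  -- termwise
  have hterm : ∀ r' ∈ Fintype.piFinset (fun i => Jprimes X τ (mInit m i)),
      ‖(initCoeff X τ m r' : ℂ) * grossenChar hq χ j k (∏ i, r' i) * (((den)⁻¹ : ℝ) : ℂ) *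
          ∑ y ∈ (Jprimes X τ (m (Fin.last n))).filter
              (fun y => normForm x < initNorm r' * (Ideal.absNorm y : ℝ) ∧ initNorm r' * (Ideal.absNorm y : ℝ) ≤ normForm x + Δ * V),
            grossenChar hq χ j k y * Real.log (Ideal.absNorm y)‖ ≤
        A₂ * E₁ * den⁻¹ * (initCoeff X τ m r' / initNorm r') := by
    intro r' hr'
    have hr'0 : ∀ i, r' i ≠ ⊥ := fun i => by
      have h := Fintype.mem_piFinset.mp hr' i
      rw [mem_Jprimes_iff] at h; exact h.2.1
    have hPp : 0 < initNorm r' := initNorm_pos hr'0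
    rw [filter_Jprimes_window_eq hX0 (m (Fin.last n)) hPp]
    set a : ℝ := max ((⌈lo⌉₊ : ℝ) - 1) (normForm x / initNorm r') with ha
    set b : ℝ := min ((⌈hi⌉₊ : ℝ) - 1) ((normForm x + Δ * V) / initNorm r') with hb
    have hA₀a : A₀ ≤ a := by
      refine le_trans ?_ (le_max_left _ _)
      have : lo ≤ (⌈lo⌉₊ : ℝ) := Nat.le_ceil lo
      linarith [hlo_ge.trans this]
    have hbB : b ≤ A₂ / initNorm r' := min_le_right _ _
    have hB0 : 0 ≤ A₂ / initNorm r' := div_nonneg hA₂0.le hPp.le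
    have hbpos : 0 < b := by
      rw [hb]; refine lt_min ?_ (div_pos hA₂0 hPp)
      have : (3 : ℝ) ≤ (⌈hi⌉₊ : ℝ) := (h3.trans (hlo_ge.trans (Real.rpow_le_rpow_of_exponent_le hX.le (by nlinarith)))).trans (Nat.le_ceil hi)
      linarith
    have hbΛ : Real.log b ≤ 3 / 2 * Real.log X := by
      have hbhi : b ≤ hi := by
        refine (min_le_left _ _).trans ?_
        have := Nat.ceil_lt_add_one hhi0.le; linarith
      calc Real.log b ≤ Real.log hi := Real.log_le_log hbpos hbhi
        _ ≤ Real.log (X ^ (3 / 2 : ℝ)) := Real.log_le_log hhi0 hhi_le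
        _ = 3 / 2 * Real.log X := Real.log_rpow hX0 _
    have hinner := norm_innerWindow_le (norm_grossenChar_le hq χ j k) hA₀ hc₉ hC₉ (by positivity) hθ hA₀a hbB hB0 hbΛ
    rw [norm_mul, norm_mul, norm_mul, Complex.norm_real, Complex.norm_real, Real.norm_eq_abs, Real.norm_eq_abs,
      abs_of_nonneg (initCoeff_nonneg hX hτ r'), abs_of_pos (inv_pos.mpr hden0)]
    have hν : ‖grossenChar hq χ j k (∏ i, r' i)‖ ≤ 1 := norm_grossenChar_le hq χ j k _
    calc initCoeff X τ m r' * ‖grossenChar hq χ j k (∏ i, r' i)‖ * den⁻¹ *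
          ‖∑ P ∈ (primesIoc a b).filter (fun P => (Ideal.absNorm P).Prime), grossenChar hq χ j k P * Real.log (Ideal.absNorm P)‖
        ≤ initCoeff X τ m r' * 1 * den⁻¹ * (A₂ / initNorm r' * E₁) := by
          have h0 : 0 ≤ initCoeff X τ m r' := initCoeff_nonneg hX hτ r'
          apply mul_le_mul _ hinner (norm_nonneg _) (by positivity)
          exact mul_le_mul_of_nonneg_right (mul_le_mul_of_nonneg_left hν h0) (inv_pos.mpr hden0).le
      _ = A₂ * E₁ * den⁻¹ * (initCoeff X τ m r' / initNorm r') := by field_simp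
  have hsum := sum_initCoeff_div_initNorm_le hc hC₀ hθ₁ hX hτ hτ1 h3 hm
  rw [← hδ] at hsum
  calc ‖∑ r' ∈ Fintype.piFinset (fun i => Jprimes X τ (mInit m i)),
          (initCoeff X τ m r' : ℂ) * grossenChar hq χ j k (∏ i, r' i) * (((den)⁻¹ : ℝ) : ℂ) *
            ∑ y ∈ (Jprimes X τ (m (Fin.last n))).filter
                (fun y => normForm x < initNorm r' * (Ideal.absNorm y : ℝ) ∧ initNorm r' * (Ideal.absNorm y : ℝ) ≤ normForm x + Δ * V),
              grossenChar hq χ j k y * Real.log (Ideal.absNorm y)‖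
      ≤ ∑ r' ∈ Fintype.piFinset (fun i => Jprimes X τ (mInit m i)), A₂ * E₁ * den⁻¹ * (initCoeff X τ m r' / initNorm r') :=
        (norm_sum_le _ _).trans (Finset.sum_le_sum hterm)
    _ = A₂ * E₁ * den⁻¹ * ∑ r' ∈ Fintype.piFinset (fun i => Jprimes X τ (mInit m i)), initCoeff X τ m r' / initNorm r' := by
        rw [Finset.mul_sum]
    _ ≤ A₂ * E₁ * den⁻¹ * ((∏ i, (mInit m i : ℝ))⁻¹ * (1 + δ) ^ n) :=
        mul_le_mul_of_nonneg_left hsum (by positivity)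
    _ = A₂ * E₁ * (1 + δ) ^ n / ((∏ i, (m i : ℝ)) * (hbXi τ * Real.log X)) := by
        rw [Fin.prod_univ_castSucc, hden]
        simp only [mInit]
        field_simp

end Literature.NumberTheory.Sieve.CubicSieve
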